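import Mathlib
import Literature.Algebra.Homology.HerbrandQuotient

/-!
# STUB-IDEAS k2 (gen 34) — R204 / R203 / R193′: THE Δ-STEP IS INVISIBLE TO Λ-DUALS
# («count once» = count ZERO; digits `(0, 1, 1)` EXACTLY; `descend_existsUnique` with TRUE binders)

Stub of record: `stub_heegnerIndexLowerAtTwo` (crux item `stmt-BirchSwinnertonDyer-27851`, route
`PrintCf2`).  Node: the (3)₂ descent residue of road UTD — STUB-PLAN v6.3 rows 89 / 92,
certificate `CriticK2G32`, recommendations **R203** (corrected Δ-step receptacle `coker d₂ ≃ ker ι`,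
kernel defect `∣ 2`, `descDigits = (0, ≤ 1, 1)`), **R204** (book `D_desc ≤ 1` per key in R170″;
identification with k2-g28's Kato-side Δ-bit OWED, «count once») and **R193′** (instantiate in print).

TECHNIQUE (payload, k = 2): literature transfer with a typed dictionary.  Transferred:
* Nekovář, *Selmer complexes* (Astérisque 310) 8.9.7 p. 241 «`F_Γ(T) = F_{Γ₀}(F_Δ(T))`» — a finite
  `Δ` is absorbed into the COEFFICIENT (`T_Δ = T ⊗ ℤ₂[Δ]^ι`), so the Δ-step `M_cyc → M` is
  coefficient functoriality `T_Δ → T` and BOTH long exact sequences of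
  `0 → T⁻ → T_Δ → T → 0` and `0 → T⁺ → T_Δ → T⁻ → 0` are available (8.4.8.1–4 need `Γ' ≅ ℤ_p^{r'}`,
  p. 214 l. 31 / p. 215 — they are NOT used for the Δ-step);
* Serre, *Local Fields* VIII §4 Prop. 8 = the tree's
  `Literature.Algebra.Homology.Herbrand.natCard_H0_eq_natCard_H1` (`#Ĥ⁰ = #Ĥ⁻¹` for a finite module);
* Kato, Astérisque 295, Lemma 17.12 / (17.12.1) / (17.13.1) «exact if `p ≠ 2`, exact up to ×2 if
  `p = 2`» (p. 278–279) and p. 280 l. 2 «in the case 𝔭 ∋ p we assume p ≠ 2»;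
* Rees / Matsumura, *Commutative Ring Theory* §16 (p. 131): `grade M = inf{i : Extⁱ_A(M,A) ≠ 0}
  = depth(ann M, A)`; for `A = Λ = ℤ₂⟦T⟧` and `M` finite, `ann M ⊇ 𝔪^k`, `depth = 2`:
  `Hom_Λ(F, Λ) = Ext¹_Λ(F, Λ) = 0` for every finite `F`;
* Flach, *On the cyclotomic main conjecture for the prime 2* (Crelle 661 (2011)) pp. 1–2, 7: at
  `l = 2` «Λ is never regular (complex conjugation)», the height-one primes CONTAINING 2 are exactly
  where perfectness alone is insufficient, Coleman's sequence (8) is exact upstairs, and Coleman's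
  reciprocity law «includes the case l = 2» (Perrin-Riou's Thm 4.3.2 for `V = V₀(1)`, `V₀` unramified).

THE DICTIONARY (objects of row 92 / `CriticK2G32`; `Δ = {±1} ⊂ 𝒢 = Gal(ℚ₂(μ_{2^∞})/ℚ₂) = Δ × Γ`
canonically, `Λ = ℤ₂⟦Γ⟧`, `T = T(key)`, `M_cyc = H¹_Iw(ℚ₂(μ_{2^∞}), T) = H¹_Iw(ℚ₂^cyc, T_Δ)`,
`M = H¹_Iw(ℚ₂^cyc, T)`, `Z = H²_Iw(ℚ₂^cyc, T⁻)`, `ZΔ = H²_Iw(ℚ₂^cyc, T_Δ)`, `Z₁ = H²_Iw(ℚ₂^cyc, T)`,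
`d₂ : M_cyc → M` the corestriction = the map induced by `T_Δ → T`):
  hexagon I  (`0 → T⁻ → T_Δ → T → 0`):  `0 → K := H¹_Iw(T⁻) →j M_cyc →d₂ M →δ Z →ι ZΔ →ν Z₁ → 0`;
  hexagon II (`0 → T⁺ → T_Δ → T⁻ → 0`):  `0 → M →j' M_cyc →q K →δ' Z₁ →ι' ZΔ →ν' Z → 0`;
  and `j ∘ q = (c − 1)•` on `M_cyc` (the composite `T_Δ ↠ T_Δ/(1+c) ≅ (c−1)T_Δ ↪ T_Δ` is
  multiplication by `c − 1`).  Both start with `0` because `H⁰_Iw(ℚ₂^cyc, T^{±}) = 0`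
  (`η = β^{ur}·χ_key` is non-trivial on every open subgroup) and both end with `0` because `cd₂ = 2`.
  COKERNEL BIT: `coker d₂ ≃ ker ι`, `#ker ι = #Z·#Z₁/#ZΔ = 2` (critic §3) — and `ker ι ≅ Ĥ⁰(Δ, ZΔ)`
    (`Z = (ZΔ ⊗ sgn)_Δ = ZΔ/(1+c)`, `ι` = multiplication by `c − 1`, kernel `ZΔ^{c=1}/(1+c)ZΔ`).
  KERNEL BIT (NEW, §1): `ker d₂ = j(K)` and `(c−1)M_cyc = j(q(M_cyc))`, so
    `ker d̄₂ = ker d₂/(c−1)M_cyc ≃ K/q(M_cyc) = coker q ≃ ker ι'`, `#ker ι' = #Z₁·#Z/#ZΔ = 2`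
    — the SAME count (hexagon II is hexagon I with `Z ↔ Z₁`), and `ker ι' ≅ Ĥ⁰(Δ, ZΔ ⊗ sgn)
    = Ĥ⁻¹(Δ, ZΔ)`; a priori `#Ĥ⁰(Δ,ZΔ) = #Ĥ⁻¹(Δ,ZΔ)` by Serre VIII §4 Prop. 8 (`ZΔ` finite).
  Hence R203's `descDigits` is `(0, 1, 1)` EXACTLY for all six keys (§2), not `(0, ≤ 1, 1)`.
  KATO SIDE («count once», the identification R204 owes): on road UTD one takes Δ-COINVARIANTS of
    Kato's Coleman sequence `0 → A → M_cyc →Col_𝒢 Λ(𝒢) → B → 0` (Lemma 17.12, all `p`: for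
    `T(key) = ℤ₂(α^{ur}) ⊗ θ_e`, `α = (−1)^c β`, one has `A = H⁰ = 0` and `B ↪ T₀/(α − 1)T₀`, a
    cyclic group of order `#ZΔ ∈ {2, 4}`).  `Λ(𝒢) = Λ[Δ]` is Δ-free, so `ker (Col_𝒢)_Δ ≅ H₁(Δ, B)`
    and `coker (Col_𝒢)_Δ = B_Δ`.  Because `Λ` is torsion-free and `H₁(Δ, B)` is finite,
    `ker (Col_𝒢)_Δ = tors_Λ (M_cyc)_Δ`; because `M` is torsion-free (Perrin-Riou: `tors H¹_Iw = H⁰`)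
    and `ker d̄₂ ≅ Ĥ⁻¹(Δ, ZΔ)` is killed by `2`, `ker d̄₂ = tors_Λ (M_cyc)_Δ` as well: ONE subgroup
    `≅ ℤ/2`, counted ONCE — Kato's kernel-side `×2` and the hexagon's kernel bit coincide as SETS.
    Whatever part of the «×2» of (17.13.1) comes from the `±`-splitting (12.1.2) costs 0 here: road
    UTD takes coinvariants of the free `Λ[Δ]`-module `Λ(𝒢)`, an exact operation (§4, B46).
  BOOKKEEPING CONSEQUENCE (§5, located and falsifiable): `Col_line` is injective (`M` torsion-free of
    rank one), so `[Λ : Col_line(M)]·[M : im d̄₂] = [Λ : (Col_𝒢)_Δ(P)] = #B_Δ`, i.e.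
    `[Λ : Col_line(M)] = #B_Δ / 2`; finiteness forces `Col_line ∈ Λˣ·g` (`g` the generator of
    `Hom_Λ(M, Λ) ≅ Λ`; k1-g26 `isUnit_ratio_of_isRelPrime_values`, cited) for ALL six keys, and for
    the three keys with `c = 0` (`#B ≤ 2`, while `#B_Δ = 2·[Λ : Col_line M] ≥ 2`) it forces `B = ℤ/2`,
    `Col_line : M ⥲ Λ` an ISOMORPHISM and `M = H¹_Iw(ℚ₂^cyc, T(key))` FREE of rank one, `M_cyc ≅ 𝔐`
    (the maximal ideal of `Λ(𝒢)`, not free) — PREDICTION P*, cheapest falsifier in the card.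
  INVISIBILITY (NEW, §3 — the R204 booking): a `Λ`-valued functional sees NEITHER bit:
    the kernel bit is 2-torsion and `Λ` is torsion-free (`factors_of_ker_two_torsion`); the cokernel
    bit is a finite-index extension problem and `Hom_Λ(M, Λ) → Hom_Λ(im d₂, Λ)` is a BIJECTION because
    `(2, T)` is a regular pair killing `M/im d₂ ≅ ℤ/2` (`dual_extend_existsUnique` — the elementwise
    form of `Ext⁰ = Ext¹ = 0`).  Consequence `descend_existsUnique'`: k3-g28's `descend_existsUnique`
    with its two FALSE-at-2 binders (`hd : Surjective d`, `hker : ker d ⊆ I·M₂`) replaced by two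
    TRUE ones (`coker` killed by a regular pair, `ker` killed by 2): the descended Coleman functional
    `Col_line : M →ₗ[Λ] Λ` EXISTS, is UNIQUE and is `Λ`-valued (no `½`) for all six keys;
    `D_desc(key) = 0` ×6 in R170″; at a universal norm `u_W = d₂(y)` (R194) its value is
    `(Col_𝒢 y)_Δ` on the nose (`value_at_universalNorm`).

Everything below is sorry-free module algebra over an arbitrary commutative ring; the Galois
inputs (the two hexagons, the `H²_Iw` table, `H⁰_Iw = 0`) are print / `CriticK2G32` (pages in the
card).  BSD is NOT proved by any of this; the stub, the crux, (2)₂, (3)₂ and LOWER are not proved;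
nothing closes.
-/

set_option linter.dupNamespace false
set_option linter.unusedSectionVars false

universe u

namespace Summit.BirchSwinnertonDyer.BirchSwinnertonDyer.Cruxes.SplitBadTwoLowerHalfOfFacts.DeltaInvisibleK2G34

/-! ## §1  Hexagon II decides the kernel bit: `ker d̄₂ ≃ coker q ≃ ker ι'` -/

section KernelBit

variable {R : Type*} [CommRing R] {Mc K Z₁ ZΔ Z : Type*}
  [AddCommGroup Mc] [Module R Mc] [AddCommGroup K] [Module R K] [AddCommGroup Z₁] [Module R Z₁]
  [AddCommGroup ZΔ] [Module R ZΔ] [AddCommGroup Z] [Module R Z]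

/-- `coker(q : M_cyc → K) ≃ ker(ι' : Z₁ → ZΔ)` from exactness of hexagon II at `K` and at `Z₁`
(the critic's `CriticK2G32.cokerEquivKer` read on the swapped hexagon). [folklore] -/
noncomputable def cokerEquivKer (q : Mc →ₗ[R] K) (δ' : K →ₗ[R] Z₁) (ι' : Z₁ →ₗ[R] ZΔ)
    (hqδ : LinearMap.range q = LinearMap.ker δ') (hδι : LinearMap.range δ' = LinearMap.ker ι') :
    (K ⧸ LinearMap.range q) ≃ₗ[R] LinearMap.ker ι' :=
  ((Submodule.quotEquivOfEq _ _ hqδ).trans δ'.quotKerEquivRange).trans (LinearEquiv.ofEq _ _ hδι)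

/-- The KERNEL DEFECT of the Δ-step, as a module: inside `M_cyc`, `ker d₂ = j(K)` (hexagon I) and
`(c − 1)M_cyc = j(q(M_cyc))` (because `j ∘ q = (c−1)•`); for `j` injective (`H⁰_Iw(ℚ₂^cyc, T) = 0`)
the quotient `j(K)/j(q(M_cyc))` is `K/q(M_cyc) = coker q`. [folklore] -/
noncomputable def kerDefectEquiv (j : K →ₗ[R] Mc) (hj : Function.Injective j) (q : Mc →ₗ[R] K) :
    (K ⧸ LinearMap.range q) ≃ₗ[R]
      (LinearMap.range j ⧸ (LinearMap.range (j ∘ₗ q)).comap (LinearMap.range j).subtype) :=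
  Submodule.Quotient.equiv (LinearMap.range q)
    ((LinearMap.range (j ∘ₗ q)).comap (LinearMap.range j).subtype)
    (LinearEquiv.ofInjective j hj) (by
      ext ⟨x, hx⟩
      simp only [Submodule.mem_map, LinearMap.mem_range, Submodule.mem_comap,
        Submodule.subtype_apply, LinearMap.coe_comp, Function.comp_apply]
      constructor
      · rintro ⟨y, ⟨m, rfl⟩, hy⟩
        refine ⟨m, ?_⟩
        have := congrArg Subtype.val hy
        simpa [LinearEquiv.ofInjective_apply] using this
      · rintro ⟨m, hm⟩
        refine ⟨q m, ⟨m, rfl⟩, ?_⟩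
        apply Subtype.ext
        simpa [LinearEquiv.ofInjective_apply] using hm)

/-- **The kernel bit equals `#ker ι'`** (`= #Z₁·#Z/#ZΔ`, §1's count below): the index
`[ker d₂ : (c−1)M_cyc]` as the cardinality of the module `j(K)/j(q M_cyc)`. [folklore] -/
theorem natCard_kerDefect (j : K →ₗ[R] Mc) (hj : Function.Injective j) (q : Mc →ₗ[R] K)
    (δ' : K →ₗ[R] Z₁) (ι' : Z₁ →ₗ[R] ZΔ)
    (hqδ : LinearMap.range q = LinearMap.ker δ') (hδι : LinearMap.range δ' = LinearMap.ker ι') :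
    Nat.card (LinearMap.range j ⧸ (LinearMap.range (j ∘ₗ q)).comap (LinearMap.range j).subtype)
      = Nat.card (LinearMap.ker ι') := by
  rw [← Nat.card_congr (kerDefectEquiv j hj q).toEquiv]
  exact Nat.card_congr (cokerEquivKer q δ' ι' hqδ hδι).toEquiv

/-- The count on the tail `Z₁ →ι' ZΔ →ν' Z → 0` of hexagon II: `#ker ι' · #ZΔ = #Z₁ · #Z` — the
critic's formula `#coker·#ZΔ = #Z·#Z₁` is SYMMETRIC under `Z ↔ Z₁`, so the kernel bit and the
cokernel bit have the same order (`= 2` for all six keys, §2). [folklore] -/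
theorem natCard_ker_mul (ι' : Z₁ →ₗ[R] ZΔ) (ν' : ZΔ →ₗ[R] Z)
    (hιν : LinearMap.range ι' = LinearMap.ker ν') (hν : Function.Surjective ν') :
    Nat.card (LinearMap.ker ι') * Nat.card ZΔ = Nat.card Z₁ * Nat.card Z := by
  have h2 : Nat.card Z₁ = Nat.card (LinearMap.ker ι') * Nat.card (LinearMap.range ι') := by
    rw [Submodule.card_eq_card_quotient_mul_card (LinearMap.ker ι'),
      Nat.card_congr ι'.quotKerEquivRange.toEquiv]
  have h3 : Nat.card ZΔ = Nat.card (LinearMap.ker ν') * Nat.card (LinearMap.range ν') := by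
    rw [Submodule.card_eq_card_quotient_mul_card (LinearMap.ker ν'),
      Nat.card_congr ν'.quotKerEquivRange.toEquiv]
  have h4 : Nat.card (LinearMap.range ν') = Nat.card Z := by
    rw [LinearMap.range_eq_top.mpr hν]
    exact Nat.card_congr (Submodule.topEquiv (R := R) (M := Z)).toEquiv
  rw [h3, h2, hιν, h4]; ring

/-- A priori form of the symmetry: for a FINITE module over a finite cyclic group the two Tate groups
have the same order, `#Ĥ⁰(Δ, ZΔ) = #Ĥ⁻¹(Δ, ZΔ)` — the tree's Serre VIII §4 Prop. 8, cited BY NAME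
(the kernel bit lives in `Ĥ⁻¹(Δ, ZΔ)`, the cokernel bit in `Ĥ⁰(Δ, ZΔ)`). [cite: Serre1979, VIII §4] -/
example {k G : Type u} [CommRing k] [CommGroup G] [Fintype G] (A : Rep.{u} k G) (g : G)
    [Finite A.V] (hg : ∀ x, x ∈ Subgroup.zpowers g) :
    Nat.card (Literature.Algebra.Homology.Herbrand.H0 A) =
      Nat.card (Literature.Algebra.Homology.Herbrand.H1 A) :=
  Literature.Algebra.Homology.Herbrand.natCard_H0_eq_natCard_H1 A g hg

end KernelBit

/-! ## §2  The six keys: both bits are exactly one — `descDigits = (0, 1, 1)` -/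

/-- The three ramified twist classes `e ∈ {−1, 2, −2}`; keys are `TwistE × Bool` (B52). -/
inductive TwistE | neg1 | two | neg2
  deriving DecidableEq, Repr

instance : Fintype TwistE := ⟨{.neg1, .two, .neg2}, by intro x; cases x <;> simp⟩

/-- `(#Z, #ZΔ, #Z₁) = (#H²_Iw(T⁻), #H²_Iw(T_Δ), #H²_Iw(T))` per key — the kernel-certified table of
`CriticK2G32.table` (`β ≡ 11 (mod 16)`), COPIED (not re-derived). -/
def h2Table : TwistE → Bool → ℕ × ℕ × ℕ
  | _,     false => (2, 2, 2)
  | .neg1, true  => (2, 4, 4)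
  | .neg2, true  => (2, 4, 4)
  | .two,  true  => (4, 4, 2)

/-- Order of the cokernel bit `#ker ι = #Z·#Z₁/#ZΔ` and of the kernel bit `#ker ι' = #Z₁·#Z/#ZΔ`. -/
def cokerBit (e : TwistE) (c : Bool) : ℕ :=
  let t := h2Table e c; t.1 * t.2.2 / t.2.1
def kernelBit (e : TwistE) (c : Bool) : ℕ :=
  let t := h2Table e c; t.2.2 * t.1 / t.2.1

/-- Both bits have order EXACTLY `2` on all six keys (the divisions are exact: `#Z·#Z₁ = 2·#ZΔ`). -/
theorem bits_eq_two : ∀ e c, cokerBit e c = 2 ∧ kernelBit e c = 2 ∧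
    (h2Table e c).1 * (h2Table e c).2.2 = 2 * (h2Table e c).2.1 := by decide

/-- R203's located digit vector of the descent `M₂ → M_cyc → M` per key:
(tf-step cokernel, Δ-step kernel defect, Δ-step cokernel) in bits. -/
def descDigits (e : TwistE) (c : Bool) : ℕ × ℕ × ℕ :=
  (0, Nat.log 2 (kernelBit e c), Nat.log 2 (cokerBit e c))

/-- `descDigits = (0, 1, 1)` EXACTLY for all six keys (v6.3 had `(0, ≤ 1, 1)`). -/
theorem descDigits_eq : ∀ e c, descDigits e c = (0, 1, 1) := by decide

/-- … and R204's booked column: what a `Λ`-VALUED functional sees of them (§3): nothing. -/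
def dDesc (_e : TwistE) (_c : Bool) : ℕ := 0

/-! ## §3  Invisibility: a `Λ`-dual sees neither bit (`Hom(tors, Λ) = 0`, `Ext¹(finite, Λ) = 0`) -/

section Invisible

variable {R : Type*} [CommRing R] {P M L : Type*} [AddCommGroup P] [Module R P]
  [AddCommGroup M] [Module R M] [AddCommGroup L] [Module R L]

/-- KERNEL BIT IS INVISIBLE: a map `g : P → L` into a module without 2-torsion factors through any
`f : P → M` whose kernel is killed by `2` (here `P = (M_cyc)_Δ`, `f = d̄₂`, `ker d̄₂ ≅ Ĥ⁻¹(Δ, ZΔ)`,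
`L = Λ(𝒢)_Δ = Λ`, `g = (Col_𝒢)_Δ`). [folklore] -/
theorem factors_of_ker_two_torsion (f : P →ₗ[R] M) (g : P →ₗ[R] L)
    (hker : ∀ x ∈ LinearMap.ker f, (2 : R) • x = 0) (hL : ∀ y : L, (2 : R) • y = 0 → y = 0) :
    ∃ h : LinearMap.range f →ₗ[R] L, h ∘ₗ f.rangeRestrict = g := by
  have hle : LinearMap.ker f ≤ LinearMap.ker g := by
    intro x hx
    rw [LinearMap.mem_ker]
    apply hL
    rw [← map_smul, hker x hx, map_zero]
  refine ⟨(LinearMap.ker f).liftQ g hle ∘ₗ f.quotKerEquivRange.symm.toLinearMap, ?_⟩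
  ext x
  have h1 : f.quotKerEquivRange.symm (f.rangeRestrict x) = Submodule.Quotient.mk x := by
    rw [LinearEquiv.symm_apply_eq]
    apply Subtype.ext
    simp
  simp [h1]

/-- COKERNEL BIT IS INVISIBLE (elementwise `Ext¹_R(M/N, R) = 0 = Hom_R(M/N, R)`): if a REGULAR PAIR
`(a, b)` (`a` a non-zero-divisor, `b` a non-zero-divisor modulo `a`) kills `M/N`, every `R`-valued
functional on `N` extends UNIQUELY to `M` — with values in `R`, no denominators.  Here `R = Λ = ℤ₂⟦T⟧`,
`(a, b) = (2, T)`, `N = im d₂`, `M/N ≅ Ĥ⁰(Δ, ZΔ) ≅ ℤ/2 = Λ/𝔪`. [folklore] -/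
theorem dual_extend_existsUnique (a b : R) (ha : a ∈ nonZeroDivisors R)
    (hab : ∀ x : R, a ∣ b * x → a ∣ x) (N : Submodule R M)
    (haN : ∀ m : M, a • m ∈ N) (hbN : ∀ m : M, b • m ∈ N) (f : N →ₗ[R] R) :
    ∃! g : M →ₗ[R] R, g ∘ₗ N.subtype = f := by
  -- `a ∣ f(a m)`: from `b·f(a m) = f(b a m) = f(a b m) = a·f(b m)` and regularity of the pair
  have key : ∀ m : M, ∃ c : R, f ⟨a • m, haN m⟩ = a * c := by
    intro m
    have e1 : b • (⟨a • m, haN m⟩ : N) = a • (⟨b • m, hbN m⟩ : N) := by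
      apply Subtype.ext
      simp [smul_smul, mul_comm]
    have e2 : b * f ⟨a • m, haN m⟩ = a * f ⟨b • m, hbN m⟩ := by
      have h := congrArg f e1
      rw [map_smul, map_smul] at h
      simpa only [smul_eq_mul] using h
    obtain ⟨c, hc⟩ := hab (f ⟨a • m, haN m⟩) ⟨f ⟨b • m, hbN m⟩, e2⟩
    exact ⟨c, hc⟩
  choose g₀ hg₀ using key
  have cancel : ∀ x y : R, a * x = a * y → x = y :=
    fun x y h => (mul_cancel_left_mem_nonZeroDivisors ha).mp h
  -- the extension
  let g : M →ₗ[R] R :=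
    { toFun := g₀
      map_add' := by
        intro m m'
        apply cancel
        have e : (⟨a • (m + m'), haN (m + m')⟩ : N) = ⟨a • m, haN m⟩ + ⟨a • m', haN m'⟩ := by
          apply Subtype.ext; simp [smul_add]
        rw [← hg₀, e, map_add, hg₀, hg₀, mul_add]
      map_smul' := by
        intro r m
        apply cancel
        have e : (⟨a • (r • m), haN (r • m)⟩ : N) = r • ⟨a • m, haN m⟩ := by
          apply Subtype.ext
          rw [Submodule.coe_smul]
          exact smul_comm a r m
        rw [← hg₀, e, map_smul, hg₀, smul_eq_mul, RingHom.id_apply, smul_eq_mul]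
        ring }
  have hg : g ∘ₗ N.subtype = f := by
    ext n
    apply cancel
    have e : (⟨a • (n : M), haN n⟩ : N) = a • n := Subtype.ext rfl
    show a * g₀ n = a * f n
    rw [← hg₀, e, map_smul, smul_eq_mul]
  refine ⟨g, hg, ?_⟩
  intro g' hg'
  ext m
  apply cancel
  have e1 : a * g' m = f ⟨a • m, haN m⟩ := by
    rw [← smul_eq_mul, ← map_smul, ← hg']; rfl
  have e2 : a * g m = f ⟨a • m, haN m⟩ := by
    rw [← smul_eq_mul, ← map_smul, ← hg]; rfl
  rw [e1, e2]

/-- **`descend_existsUnique'` — k3-g28's DESC with TRUE binders at `p = 2`.**  `d : P → M`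
(`P = (M_cyc)_Δ`, `d = d̄₂`) need NOT be onto and its kernel need NOT lie in `I·P`: it suffices that
`ker d` is killed by `2` (the kernel bit, `Ĥ⁻¹(Δ, ZΔ)`), that `2` is a non-zero-divisor of `R = Λ`
with `b = T` regular modulo `2`, and that `2` and `b` kill `coker d` (the cokernel bit `Ĥ⁰(Δ, ZΔ) ≅
Λ/𝔪`).  Then every functional `Col : P → R` descends to a UNIQUE `R`-valued `ColM : M → R` with
`ColM ∘ d = Col`.  (For all six keys both bits are `ℤ/2`, §2.) [folklore] -/
theorem descend_existsUnique' (d : P →ₗ[R] M) (Col : P →ₗ[R] R)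
    (hker : ∀ x ∈ LinearMap.ker d, (2 : R) • x = 0) (h2 : (2 : R) ∈ nonZeroDivisors R)
    (b : R) (hab : ∀ x : R, (2 : R) ∣ b * x → (2 : R) ∣ x)
    (h2M : ∀ m : M, (2 : R) • m ∈ LinearMap.range d) (hbM : ∀ m : M, b • m ∈ LinearMap.range d) :
    ∃! ColM : M →ₗ[R] R, ColM ∘ₗ d = Col := by
  have hR : ∀ y : R, (2 : R) • y = 0 → y = 0 := by
    intro y hy
    rw [smul_eq_mul] at hy
    exact (mul_cancel_left_mem_nonZeroDivisors h2).mp (by rw [hy, mul_zero])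
  obtain ⟨h, hh⟩ := factors_of_ker_two_torsion d Col hker hR
  obtain ⟨g, hg, huniq⟩ := dual_extend_existsUnique (2 : R) b h2 hab (LinearMap.range d) h2M hbM h
  have hsub : (LinearMap.range d).subtype ∘ₗ d.rangeRestrict = d := by ext x; rfl
  refine ⟨g, ?_, ?_⟩
  · show g ∘ₗ d = Col
    rw [← hsub, ← LinearMap.comp_assoc, hg, hh]
  · intro g' hg'
    apply huniq
    have : (g' ∘ₗ (LinearMap.range d).subtype) ∘ₗ d.rangeRestrict = h ∘ₗ d.rangeRestrict := by
      rw [LinearMap.comp_assoc, hsub, hg', hh]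
    exact (LinearMap.cancel_right d.surjective_rangeRestrict).mp this

/-- `D_desc = 0` AT A UNIVERSAL NORM (R194): on `im d` the descended functional takes the upstairs
value on the nose — nothing integral about the descent is consumed by the VALUE. [folklore] -/
theorem value_at_universalNorm {d : P →ₗ[R] M} {Col : P →ₗ[R] R} {ColM : M →ₗ[R] R}
    (h : ColM ∘ₗ d = Col) (y : P) : ColM (d y) = Col y := by
  rw [← h]; rfl

/-- The regular-pair hypothesis of `dual_extend_existsUnique` in the shape it is used: over a domain
in which `a` is PRIME and does not divide `b`, `a ∣ b·x → a ∣ x`.  (`Λ = ℤ₂⟦T⟧` is a UFD, `2` is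
prime — `Λ/2 = 𝔽₂⟦T⟧` is a domain — and `2 ∤ T`.) [folklore] -/
theorem regularPair_of_prime {A : Type*} [CommRing A] {a b : A} (ha : Prime a) (hb : ¬ a ∣ b)
    (x : A) (h : a ∣ b * x) : a ∣ x :=
  (ha.dvd_or_dvd h).resolve_left hb

end Invisible

/-! ## §4  Kato's (12.1.2) costs nothing on road UTD (shadow) -/

/-- Kato (12.1.2): `Λ[Δ] → Λ₊ × Λ₋`, `a + b·c ↦ (a + b, a − b)`, has determinant `−2` — cokernel
killed by (and of order) `2`.  Road UTD never splits `Λ(𝒢) = Λ[Δ]` into `±`-parts: it takes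
Δ-COINVARIANTS, which on the free module `Λ[Δ]` is the exact functor `Λ[Δ] ↠ Λ` (no bit). -/
theorem kato_12_1_2_det : Matrix.det !![(1 : ℤ), 1; 1, -1] = -2 := by
  simp [Matrix.det_fin_two]

/-- The coinvariant quotient of the rank-one free `ℤ[C₂]`-module, in coordinates `(a, b) ↦ a + b`,
is ONTO `ℤ` with kernel the anti-diagonal `{(a, −a)}` = `(c − 1)ℤ[C₂]`: exact, no cokernel. -/
theorem coinvariants_free_exact :
    Function.Surjective (fun p : ℤ × ℤ => p.1 + p.2) ∧
    ∀ p : ℤ × ℤ, p.1 + p.2 = 0 ↔ ∃ a : ℤ, p = (a, -a) := by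
  refine ⟨fun n => ⟨(n, 0), by simp⟩, fun p => ⟨fun h => ⟨p.1, ?_⟩, ?_⟩⟩
  · ext <;> simp; omega
  · rintro ⟨a, rfl⟩; simp

/-! ## §5  Bookkeeping: `[Λ : Col_line M] = #B_Δ / 2`; `c = 0` forces freeness (prediction P*) -/

/-- Index chain `[G : C] = [G : A]·[A : C]` for `C ≤ A ≤ G` — used with `G = Λ`, `A = Col_line(M)`,
`C = Col_line(im d̄₂) = (Col_𝒢)_Δ(P)`: `#B_Δ = [Λ : Col_line M] · 2`. (Mathlib, by name.) -/
theorem index_chain {G : Type*} [AddCommGroup G] (C A : AddSubgroup G) (h : C ≤ A) :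
    C.index = A.index * C.relIndex A := by
  rw [mul_comm]; exact (AddSubgroup.relIndex_mul_index h).symm

/-- PREDICTION P* in numbers: if `#B_Δ ∣ 2` (keys with `c = 0`: `B_Δ` is a quotient of
`B ↪ T₀/(β − 1) ≅ ℤ/2`) and `#B_Δ = 2 · [Λ : Col_line M]`, then `[Λ : Col_line M] = 1`:
the descended Coleman functional is onto, hence (injective + onto) `M ≅ Λ` is FREE. -/
theorem index_one_of_c0 (bΔ idx : ℕ) (h1 : bΔ ∣ 2) (h2 : bΔ = 2 * idx) : idx = 1 := by
  have hle := Nat.le_of_dvd two_pos h1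
  have hpos : 0 < bΔ := Nat.pos_of_dvd_of_pos h1 two_pos
  omega

/-- … and for `c = 1` (`B ↪ ℤ/4`): `[Λ : Col_line M] ∈ {1, 2}`, i.e. `M ≅ Λ` or `M ≅ 𝔪 = (2, T)`
(the unique `Λ`-submodule of index `2`), decided by the Δ-action on `B` (`sgn` ↦ free). -/
theorem index_le_two_of_c1 (bΔ idx : ℕ) (h1 : bΔ ∣ 4) (h2 : bΔ = 2 * idx) : idx = 1 ∨ idx = 2 := by
  have hle := Nat.le_of_dvd (by norm_num) h1
  have hpos : 0 < bΔ := Nat.pos_of_dvd_of_pos h1 (by norm_num)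
  interval_cases bΔ <;> omega

end Summit.BirchSwinnertonDyer.BirchSwinnertonDyer.Cruxes.SplitBadTwoLowerHalfOfFacts.DeltaInvisibleK2G34
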